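import Literature.AlgebraicGeometry.HodgeTheory.TransvectionMonodromyZariskiDense
import Literature.LinearAlgebra.Alternating.SymplecticInvolutionCentralizer
import HarnessLib

/-!
# Sign-symmetric transvection monodromy is Zariski dense in `Sp(V₊) × Sp(V₋)`
# (the algebraic half of "Theorem A" for symmetric Lefschetz pencils, without Goursat)

Family `hodge`, layer `Literature/AlgebraicGeometry/HodgeTheory`; sequel of
`TransvectionMonodromyZariskiDense.lean` (Lemma T as printed: transvections along a spanning,
orthogonally connected set have Zariski-dense span in `Sp`) and of
`Literature/LinearAlgebra/Alternating/SymplecticInvolutionCentralizer.lean` (the centraliser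
`Sp(V₊) × Sp(V₋)` of an isometric involution: `halfProj`, `extendAlong`, `restrictAlong`). THEOREMS only (two private
helpers); no definition, no named fact (net debt `0`).

## The statement and its source

Deligne, *La conjecture de Weil II*, Thm (4.4.1) with Lemme (4.4.2^α) (held text
`paper:doi-10-1007-bf02684780` p0092, p. 227: "Pour que le sous-groupe compact `M` de `G` soit ouvert,
il suffit donc qu'il soit Zariski-dense […] appliquer les lemmes algébriques (4.4.2^α) […] à la clôture
de Zariski de `M` dans `G` et à la classe de conjugaison des transformations de Picard-Lefschetz")
treats a Lefschetz pencil whose vanishing cycles form ONE orbit. For a pencil of hypersurfaces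
INVARIANT UNDER AN INVOLUTION `ι` (route `Summits/HodgeConjecture/HodgeConjecture/Theses/SignSymmetricPowers.lean`,
crux K1 `VeryGeneralSignCommutatorsInHg`; memo ROUTE-P3v11 §3, "Theorem A") the Picard–Lefschetz
generators are of two kinds: PURE transvections `T_{δ₀}` along cycles `δ₀` fixed up to sign by `ι`
(nodes on the fixed locus; `δ₀ ∈ V₊` or `V₋`), and COMMUTING PAIRS `T_δ T_{ιδ}` (a pair of nodes
exchanged by `ι`, `⟨δ, ιδ⟩ = 0`), which are NOT separately in the monodromy group. The memo concludes
`(Γ̄)° = Sp(V₊) × Sp(V₋)` through Lemma T on each eigenspace and a Goursat argument. This file proves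
the `K`-points statement DIRECTLY, with no identity components and no Goursat step:

**Theorem** (`mem_glZariskiClosure_of_signSymmetric`). `K` of characteristic `0`, `V` finite-dimensional,
`B` alternating non-degenerate, `σ` with `σ² = 1`, `B(σx, σy) = B(x, y)`; `Γ ≤ GL(V)`; `T ⊆ V` ("fixed
centres": for each `r ∈ T` some `U_r(c)`, `c ≠ 0`, lies in `Γ`) and `D ⊆ V` ("paired centres": for each
`δ ∈ D`, `⟨δ, σδ⟩ = 0` and some `U_δ(c) U_{σδ}(c)`, `c ≠ 0`, lies in `Γ`). If for each sign the set
`R₊ = {r ∈ T | σr = r} ∪ {δ + σδ | δ ∈ D}` (resp. `R₋ = {r ∈ T | σr = -r} ∪ {δ - σδ | δ ∈ D}`) spans the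
eigenspace `V₊` (resp. `V₋`), is orthogonally connected, and contains a fixed centre when non-empty,
then EVERY `σ`-commuting `B`-isometry lies in `glZariskiClosure Γ`.

Mechanism (replacing memo §3.5–§3.7): the Zariski closure `C` of `Γ` is multiplicatively closed and
contains the full lines `U_r(K)` (`r ∈ T`) and `D_t = U_δ(t) U_{σδ}(t) = 1 + t(n_δ + n_{σδ})`, `δ ∈ D`
(`TransvectionMonodromyZariskiDense`); the set `L = {v | U_v(K) ⊆ C}` is stable under the `U_w(s)`, `w ∈ L`,
and under the `D_t`; for `l ∈ L ∩ V₊` and `f = δ + σδ` with `⟨l, f⟩ ≠ 0`: `D_t l = l + t⟨l, δ⟩ f`, and then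
`U_l(c)(l + f) = f` for the right `c` — so `f ∈ L` (`oneParamTransvection_add_self_mem`); orthogonal
connectedness of `R₊` propagates this from the fixed centres to all of `R₊`
(`forall_oneParamTransvection_mem_of_connected`); Lemma T on `V₊`
(`mem_oneParamTransvectionGroup_of_connected` for `B|V₊`) and extension by the identity (`extendAlong`)
put `Sp(V₊) × 1 ⊆ C` (`extendAlong_mem_of_connected`), likewise `1 × Sp(V₋)` (the same lemma for `-σ`),
and `g = (g|V₊ ⊕ 1)(1 ⊕ g|V₋)` (`extendAlong_restrictAlong_mul`).

* §1 lines in the closure: `oneParamTransvection_mem_closure` (fixed centres),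
  `oneParamTransvection_mul_eq_one_add_smul` (`U_δ(t)U_{δ'}(t) = 1 + t(n_δ + n_{δ'})` for `⟨δ, δ'⟩ = 0`),
  `pairLine_mem_closure` (paired centres).
* §2 admissible centres of a multiplicatively closed `C ⊆ End(V)`: `oneParamTransvection_smul`,
  `oneParamTransvection_map_mem`, `oneParamTransvection_add_smul_mem`, `pair_apply_of_fixed`,
  `oneParamTransvection_add_self_mem`, `forall_oneParamTransvection_mem_of_connected`.
* §3 `extendAlong_oneParamTransvection` (`(U^{V₊}_w(c) ⊕ 1) = U^V_w(c)`), `extendAlong_mem_of_connected`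
  (Lemma T on `V₊` + extension), and the main theorem **`mem_glZariskiClosure_of_signSymmetric`**. With
  `TransvectionMonodromyZariskiDense.isometry_of_mem_glZariskiClosure` (the closure of `Γ ≤ Sp` stays in
  `Sp`) this is "`Γ̄ ⊇ Sp(V₊) × Sp(V₋)`, `Γ̄ ⊆ Sp(V)`" on `K`-points; `σ`-commutation of the closure is
  not needed by the consumer and not proved here.
* §4 **Corollary T′ in sign form** (`orthogonallyConnected_of_signSymmetric_orbits` and `…_neg`): the
  orthogonal-connectedness hypotheses `hconnPos` / `hconnNeg` of the main theorem FROM ORBIT DATA —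
  `Γ = ⟨E⟩` commuting with `σ` and generated by transvections along fixed centres (`σ r = ±r`) and by
  pairs `U_δ(c) U_{σδ}(c)`; `T`, `D` sign-closed and `Γ`-stable; the fixed centres of the given parity ONE
  `Γ`-orbit up to sign and `D` ONE `Γ`-orbit up to sign and up to `σ` (conjugacy of the vanishing cycles of
  one irreducible component of the discriminant); ONE link `⟨r, δ⟩ ≠ 0` between the two kinds; and the
  span condition. Proof as in Deligne (4.4.2^α)/(4.4.4^α): an orthogonal splitting of `R₊` is stable
  under every generator, hence under `Γ`, and never separates `r` from `-r`, so each orbit lies on one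
  side and the link puts both on the same side (`char K ≠ 2` suffices here).
* §5 **`mem_glIdentityComponent_of_signSymmetric`**: the same conclusion inside the identity component
  `glIdentityComponent Γ = ⋂_{Γ' ≤ Γ finite index} glZariskiClosure Γ'` (for the monodromy group: the
  tree's `algebraicMonodromyGroup`), since a finite-index `Γ'` contains positive powers
  `U_r(c)^m = U_r(mc)` (`oneParamTransvectionEquiv_pow`), `(U_δ(c)U_{σδ}(c))^m = U_δ(mc)U_{σδ}(mc)`
  (`pair_oneParamTransvectionEquiv_pow`) of the generators. This is "`Mon⁰ ⊇ Sp(V₊) × Sp(V₋)`" on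
  `K`-points; with `TensorStabilizerZariskiClosed` and `Motives/MumfordTateCommutatorsHodgeGroup` it feeds
  `Mon_s ⊆ MT ⇒` commutators of the centraliser lie in `Hg` (route K1).

## References

* [Deligne1980] P. Deligne, La conjecture de Weil : II, Publ. Math. IHÉS 52 (1980), §4.4 (4.4.1)–(4.4.4^α),
  pp. 227–228.
* [CarlsonMullerStachPeters2017] J. Carlson, S. Müller-Stach, C. Peters, Period Mappings and Period Domains,
  2nd ed. (2017), Lemma–Definition 15.3.7 (`Γ^Zar`).
* [GoodmanWallachGTM255] R. Goodman, N. R. Wallach, Symmetry, Representations, and Invariants, §11.3.5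
  Type CII (`K = Sp(p) × Sp(q)`).
-/

noncomputable section

namespace Literature.AlgebraicGeometry.HodgeTheory

open Literature.AlgebraicGeometry.Motives Literature.LinearAlgebra.Alternating

universe u v

variable {K : Type u} [Field K] {V : Type v} [AddCommGroup V] [Module K V] {B : LinearMap.BilinForm K V}

/-! ## §1 Lines in the Zariski closure: fixed centres and paired centres -/

section Lines

/-- `(1 + m)^k = 1 + k m` for `m² = 0`. [folklore] -/
private theorem pow_one_add_eq_of_mul_self {A : Type*} [Ring A] [Algebra K A] {m : A} (hm : m * m = 0) (k : ℕ) :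
    (1 + m) ^ k = 1 + (k : K) • m := by
  induction k with
  | zero => rw [pow_zero, Nat.cast_zero, zero_smul, add_zero]
  | succ k ih =>
    rw [pow_succ, ih, add_mul, one_mul, mul_add, mul_one, smul_mul_assoc, hm, smul_zero, add_zero, Nat.cast_succ,
      _root_.add_smul, one_smul]
    abel

variable {ι : Type*} [Fintype ι] [DecidableEq ι]

/-- **Fixed centres give lines**: if `U_r(c) ∈ Γ` with `c ≠ 0` then every `U_r(t)` lies in the Zariski
closure of `Γ` (`char K = 0`: the powers `U_r(kc)` are infinitely many points of the line).
[cite: Deligne1980, §4.4 (4.4.1)–(4.4.2^α) p. 227] -/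
theorem oneParamTransvection_mem_closure [CharZero K] (b : Module.Basis ι K V) {Γ : Subgroup (V ≃ₗ[K] V)}
    {r : V} (hr : B r r = 0) {c : K} (hc : c ≠ 0) (hmem : oneParamTransvectionEquiv B hr c ∈ Γ) (t : K) :
    oneParamTransvection B r t ∈
      zariskiClosureEndOfBasis b ((fun h : V ≃ₗ[K] V => (h : Module.End K V)) '' (Γ : Set (V ≃ₗ[K] V))) := by
  rw [oneParamTransvection_eq_one_add_smul]
  refine one_add_smul_mem_zariskiClosureEndOfBasis b _ ?_ t
  have hinj : Function.Injective fun k : ℕ => (k : K) * c :=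
    fun k l hkl => Nat.cast_injective (mul_right_cancel₀ hc hkl)
  refine (Set.infinite_range_of_injective hinj).mono ?_
  rintro _ ⟨k, rfl⟩
  refine ⟨oneParamTransvectionEquiv B hr c ^ k, Γ.pow_mem hmem k, ?_⟩
  change ((oneParamTransvectionEquiv B hr c ^ k : V ≃ₗ[K] V) : Module.End K V) = _
  rw [coe_oneParamTransvectionEquiv_pow, oneParamTransvection_eq_one_add_smul]

omit [Fintype ι] [DecidableEq ι] in
/-- For `⟨δ, δ'⟩ = 0` the nilpotent parts multiply to zero: `n_δ n_{δ'} = 0`.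
[cite: Deligne1980, §4.4 Lemme (4.4.3^α) p. 227] -/
theorem smulRight_mul_smulRight_eq_zero {δ δ' : V} (h : B δ' δ = 0) :
    ((B.flip δ).smulRight δ : Module.End K V) * (B.flip δ').smulRight δ' = 0 := by
  ext x
  simp [h]

/-- **The commuting pair is a line**: `U_δ(t) U_{δ'}(t) = 1 + t (n_δ + n_{δ'})` for `⟨δ', δ⟩ = 0`.
[cite: Deligne1980, §4.4 Lemme (4.4.3^α) p. 227] -/
theorem oneParamTransvection_mul_eq_one_add_smul (hB : B.IsAlt) {δ δ' : V} (h : B δ δ' = 0) (t : K) :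
    oneParamTransvection B δ t * oneParamTransvection B δ' t =
      (1 : Module.End K V) + t • ((B.flip δ).smulRight δ + (B.flip δ').smulRight δ') := by
  have h' : B δ' δ = 0 := by rw [← hB.neg_eq, h, neg_zero]
  rw [oneParamTransvection_eq_one_add_smul, oneParamTransvection_eq_one_add_smul, add_mul, one_mul, mul_add,
    mul_one, smul_mul_smul_comm, smulRight_mul_smulRight_eq_zero h', smul_zero, add_zero, smul_add]
  abel

/-- Powers of automorphisms, on underlying maps. [folklore] -/
private theorem coe_toLinearMap_pow (e : V ≃ₗ[K] V) (k : ℕ) :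
    ((e ^ k : V ≃ₗ[K] V) : Module.End K V) = (e : Module.End K V) ^ k := by
  induction k with
  | zero => rw [pow_zero, pow_zero]; rfl
  | succ k ih => rw [pow_succ, pow_succ, LinearEquiv.coe_toLinearMap_mul, ih]

/-- **Paired centres give lines**: if `⟨δ, δ'⟩ = 0` and `U_δ(c) U_{δ'}(c) ∈ Γ` with `c ≠ 0`, then every
`U_δ(t) U_{δ'}(t)` lies in the Zariski closure of `Γ` (`char K = 0`).
[cite: Deligne1980, §4.4 (4.4.1)–(4.4.2^α) p. 227] -/
theorem pairLine_mem_closure [CharZero K] (hB : B.IsAlt) (b : Module.Basis ι K V) {Γ : Subgroup (V ≃ₗ[K] V)}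
    {δ δ' : V} (h : B δ δ' = 0) {c : K} (hc : c ≠ 0)
    (hmem : oneParamTransvectionEquiv B (hB δ) c * oneParamTransvectionEquiv B (hB δ') c ∈ Γ) (t : K) :
    oneParamTransvection B δ t * oneParamTransvection B δ' t ∈
      zariskiClosureEndOfBasis b ((fun h : V ≃ₗ[K] V => (h : Module.End K V)) '' (Γ : Set (V ≃ₗ[K] V))) := by
  set m : Module.End K V := (B.flip δ).smulRight δ + (B.flip δ').smulRight δ' with hm
  have h' : B δ' δ = 0 := by rw [← hB.neg_eq, h, neg_zero]
  have hmm : m * m = 0 := by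
    rw [hm, add_mul, mul_add, mul_add, smulRight_mul_smulRight_eq_zero h', smulRight_mul_smulRight_eq_zero h,
      smulRight_mul_smulRight_eq_zero (hB δ), smulRight_mul_smulRight_eq_zero (hB δ'), add_zero, add_zero]
  rw [oneParamTransvection_mul_eq_one_add_smul hB h]
  refine one_add_smul_mem_zariskiClosureEndOfBasis b m ?_ t
  have hinj : Function.Injective fun k : ℕ => (k : K) * c :=
    fun k l hkl => Nat.cast_injective (mul_right_cancel₀ hc hkl)
  refine (Set.infinite_range_of_injective hinj).mono ?_
  rintro _ ⟨k, rfl⟩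
  refine ⟨(oneParamTransvectionEquiv B (hB δ) c * oneParamTransvectionEquiv B (hB δ') c) ^ k, Γ.pow_mem hmem k, ?_⟩
  change (((oneParamTransvectionEquiv B (hB δ) c * oneParamTransvectionEquiv B (hB δ') c) ^ k : V ≃ₗ[K] V) :
    Module.End K V) = _
  have hcm : (c • m) * (c • m) = 0 := by rw [smul_mul_smul_comm, hmm, smul_zero]
  rw [coe_toLinearMap_pow, LinearEquiv.coe_toLinearMap_mul, coe_oneParamTransvectionEquiv,
    coe_oneParamTransvectionEquiv, oneParamTransvection_mul_eq_one_add_smul hB h, ← hm,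
    pow_one_add_eq_of_mul_self (K := K) hcm, smul_smul]

end Lines

/-! ## §2 Admissible centres of a multiplicatively closed set `C ⊆ End(V)` -/

section Centres

variable (B)

/-- `U_{a v}(t) = U_v(t a²)`. [cite: Deligne1980, §4.4 (4.4.4^α) p. 227] -/
theorem oneParamTransvection_smul (a : K) (v : V) (t : K) :
    oneParamTransvection B (a • v) t = oneParamTransvection B v (t * a * a) := by
  ext x
  rw [oneParamTransvection_apply, oneParamTransvection_apply, map_smul, smul_eq_mul, smul_smul,
    show t * (a * B x v) * a = t * a * a * B x v by ring]

variable {B}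

/-- **Conjugation inside `C`**: if `g ∈ C` is a `B`-isometry with `g g' = 1`, `g' ∈ C`, and all `U_v(t) ∈ C`,
then all `U_{g v}(t) = g U_v(t) g' ∈ C`. [cite: Deligne1980, §4.4 Lemme (4.4.3^α) p. 227] -/
theorem oneParamTransvection_map_mem {C : Set (Module.End K V)} (hC : ∀ x ∈ C, ∀ y ∈ C, x * y ∈ C)
    {g g' : Module.End K V} (hg : ∀ x y, B (g x) (g y) = B x y) (hgg' : g * g' = 1) (hgC : g ∈ C)
    (hg'C : g' ∈ C) {v : V} (hv : ∀ t : K, oneParamTransvection B v t ∈ C) (t : K) :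
    oneParamTransvection B (g v) t ∈ C := by
  have key : oneParamTransvection B (g v) t = g * oneParamTransvection B v t * g' := by
    rw [Module.End.mul_eq_comp (f := g), comp_oneParamTransvection_of_isometry hg, ← Module.End.mul_eq_comp,
      mul_assoc, hgg', mul_one]
  rw [key]
  exact hC _ (hC _ hgC _ (hv t)) _ hg'C

/-- `U_w(s) v = v + s⟨v, w⟩ w` is an admissible centre of `C` when `v`, `w` are.
[cite: Deligne1980, §4.4 Lemme (4.4.3^α) p. 227] -/
theorem oneParamTransvection_add_smul_mem (hB : B.IsAlt) {C : Set (Module.End K V)}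
    (hC : ∀ x ∈ C, ∀ y ∈ C, x * y ∈ C) {v w : V} (hv : ∀ t : K, oneParamTransvection B v t ∈ C)
    (hw : ∀ t : K, oneParamTransvection B w t ∈ C) (s t : K) :
    oneParamTransvection B (v + (s * B v w) • w) t ∈ C := by
  have h1 : oneParamTransvection B w s * oneParamTransvection B w (-s) = 1 := by
    rw [Module.End.mul_eq_comp, oneParamTransvection_comp B (hB w), add_neg_cancel, oneParamTransvection_zero]
    rfl
  have h := oneParamTransvection_map_mem hC (apply_oneParamTransvection_apply B hB w s) h1 (hw s) (hw (-s)) hv t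
  rwa [oneParamTransvection_apply] at h

/-- **The pair line moves fixed vectors along `δ + σδ`**: for `σ l = l`, `σ` a `B`-isometric involution,
`(U_δ(s) U_{σδ}(s)) l = l + s⟨l, δ⟩ (δ + σδ)`. [cite: GoodmanWallachGTM255, §11.3.5 Type CII (11.10)] -/
theorem pair_apply_of_fixed (hB : B.IsAlt) {σ : V →ₗ[K] V} (hσ : σ ^ 2 = 1)
    (hσB : ∀ x y, B (σ x) (σ y) = B x y) {δ l : V} (hδ : B δ (σ δ) = 0) (hl : σ l = l) (s : K) :
    (oneParamTransvection B δ s * oneParamTransvection B (σ δ) s) l = l + (s * B l δ) • (δ + σ δ) := by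
  have hσσ : σ (σ δ) = δ := by rw [← Module.End.mul_apply, ← pow_two, hσ, Module.End.one_apply]
  have h1 : B l (σ δ) = B l δ := by rw [← hσB l (σ δ), hl, hσσ]
  have h2 : B (σ δ) δ = 0 := by rw [← hB.neg_eq, hδ, neg_zero]
  rw [Module.End.mul_apply, oneParamTransvection_apply, oneParamTransvection_apply, map_add, LinearMap.add_apply,
    map_smul, LinearMap.smul_apply, h2, smul_eq_mul, mul_zero, add_zero, h1, smul_add, add_assoc, add_comm (_ • σ δ)]

/-- **A fixed admissible centre linked to a paired centre makes `δ + σδ` admissible**: if `σ l = l`, all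
`U_l(t) ∈ C`, all pair lines `U_δ(s)U_{σδ}(s) ∈ C` (`⟨δ, σδ⟩ = 0`) and `⟨l, δ⟩ ≠ 0`, then all
`U_{δ + σδ}(t) ∈ C` — `D_s l = l + s⟨l,δ⟩(δ + σδ)` and `U_l(c)(l + f) = f` for `c = -1/⟨f, l⟩` (`char K ≠ 2`).
[cite: Deligne1980, §4.4 (4.4.3^α)–(4.4.4^α) pp. 227–228] -/
theorem oneParamTransvection_add_self_mem (hB : B.IsAlt) (h2 : (2 : K) ≠ 0) {σ : V →ₗ[K] V} (hσ : σ ^ 2 = 1)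
    (hσB : ∀ x y, B (σ x) (σ y) = B x y) {C : Set (Module.End K V)} (hC : ∀ x ∈ C, ∀ y ∈ C, x * y ∈ C)
    {δ l : V} (hδ : B δ (σ δ) = 0)
    (hD : ∀ s : K, oneParamTransvection B δ s * oneParamTransvection B (σ δ) s ∈ C)
    (hl : σ l = l) (hlC : ∀ t : K, oneParamTransvection B l t ∈ C) (hlδ : B l δ ≠ 0) (t : K) :
    oneParamTransvection B (δ + σ δ) t ∈ C := by
  set f := δ + σ δ with hf
  -- `l + f` is admissible: it is `D_s l` for `s = 1/⟨l, δ⟩`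
  have hiso : ∀ s : K, ∀ x y, B ((oneParamTransvection B δ s * oneParamTransvection B (σ δ) s) x)
      ((oneParamTransvection B δ s * oneParamTransvection B (σ δ) s) y) = B x y := fun s x y => by
    rw [Module.End.mul_apply, Module.End.mul_apply, apply_oneParamTransvection_apply B hB,
      apply_oneParamTransvection_apply B hB]
  have hinv : ∀ s : K, (oneParamTransvection B δ s * oneParamTransvection B (σ δ) s) *
      (oneParamTransvection B δ (-s) * oneParamTransvection B (σ δ) (-s)) = 1 := fun s => by
    rw [oneParamTransvection_mul_eq_one_add_smul hB hδ, oneParamTransvection_mul_eq_one_add_smul hB hδ]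
    set m : Module.End K V := (B.flip δ).smulRight δ + (B.flip (σ δ)).smulRight (σ δ)
    have h' : B (σ δ) δ = 0 := by rw [← hB.neg_eq, hδ, neg_zero]
    have hmm : m * m = 0 := by
      simp only [m, add_mul, mul_add, smulRight_mul_smulRight_eq_zero h', smulRight_mul_smulRight_eq_zero hδ,
        smulRight_mul_smulRight_eq_zero (hB δ), smulRight_mul_smulRight_eq_zero (hB (σ δ)), add_zero]
    rw [add_mul, mul_add, mul_add, one_mul, mul_one, one_mul, smul_mul_smul_comm, hmm, smul_zero, add_zero,
      neg_smul]
    abel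
  have hlf : ∀ t : K, oneParamTransvection B (l + f) t ∈ C := by
    intro t
    have h := oneParamTransvection_map_mem hC (hiso (B l δ)⁻¹) (hinv _) (hD _) (hD _) hlC t
    rwa [pair_apply_of_fixed hB hσ hσB hδ hl, inv_mul_cancel₀ hlδ, one_smul] at h
  -- `U_l(c) (l + f) = f` for `c = -1/⟨l + f, l⟩`
  have hfl : B (l + f) l ≠ 0 := by
    have hσσ : σ (σ δ) = δ := by rw [← Module.End.mul_apply, ← pow_two, hσ, Module.End.one_apply]
    have h1 : B l (σ δ) = B l δ := by rw [← hσB l (σ δ), hl, hσσ]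
    rw [map_add, LinearMap.add_apply, hB l, zero_add, hf, map_add, LinearMap.add_apply, ← hB.neg_eq l δ,
      ← hB.neg_eq l (σ δ), h1, ← neg_add, neg_ne_zero, ← two_mul]
    exact mul_ne_zero h2 hlδ
  have h := oneParamTransvection_add_smul_mem hB hC hlf hlC (-(B (l + f) l)⁻¹) t
  rwa [neg_mul, inv_mul_cancel₀ hfl, neg_smul, one_smul, add_neg_cancel_comm] at h

/-- **From the fixed centres to all of `R₊`** (the cut argument): if the fixed centres `r ∈ T`, `σ r = r`,
are admissible for `C`, the pair lines of `δ ∈ D` lie in `C`, and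
`R₊ = {r ∈ T | σ r = r} ∪ {δ + σδ | δ ∈ D}` is orthogonally connected and meets `T` when non-empty, then
every element of `R₊` is admissible for `C`. [cite: Deligne1980, §4.4 (4.4.4^α) p. 228] -/
theorem forall_oneParamTransvection_mem_of_connected (hB : B.IsAlt) (h2 : (2 : K) ≠ 0) {σ : V →ₗ[K] V}
    (hσ : σ ^ 2 = 1) (hσB : ∀ x y, B (σ x) (σ y) = B x y) {C : Set (Module.End K V)}
    (hC : ∀ x ∈ C, ∀ y ∈ C, x * y ∈ C) {T D : Set V}
    (hT : ∀ r ∈ T, σ r = r → ∀ t : K, oneParamTransvection B r t ∈ C)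
    (hD : ∀ δ ∈ D, B δ (σ δ) = 0 ∧ ∀ s : K, oneParamTransvection B δ s * oneParamTransvection B (σ δ) s ∈ C)
    (hconn : ∀ A ⊆ {r ∈ T | σ r = r} ∪ (fun δ => δ + σ δ) '' D, A.Nonempty →
      A ≠ {r ∈ T | σ r = r} ∪ (fun δ => δ + σ δ) '' D →
      ∃ r ∈ A, ∃ ρ ∈ {r ∈ T | σ r = r} ∪ (fun δ => δ + σ δ) '' D, ρ ∉ A ∧ B r ρ ≠ 0)
    (hseed : ({r ∈ T | σ r = r} ∪ (fun δ => δ + σ δ) '' D).Nonempty → ∃ r ∈ T, σ r = r) :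
    ∀ ρ ∈ {r ∈ T | σ r = r} ∪ (fun δ => δ + σ δ) '' D, ∀ t : K, oneParamTransvection B ρ t ∈ C := by
  set R := {r ∈ T | σ r = r} ∪ (fun δ => δ + σ δ) '' D with hR
  have hσσ : ∀ x, σ (σ x) = x := fun x => by rw [← Module.End.mul_apply, ← pow_two, hσ, Module.End.one_apply]
  have hfix : ∀ ρ ∈ R, σ ρ = ρ := by
    rintro ρ (⟨-, hρ⟩ | ⟨δ, -, rfl⟩)
    · exact hρ
    · rw [map_add, hσσ, add_comm]
  by_cases hRne : R.Nonempty
  swap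
  · intro ρ hρ
    exact absurd ⟨ρ, hρ⟩ hRne
  let A : Set V := {ρ ∈ R | ∀ t : K, oneParamTransvection B ρ t ∈ C}
  have hAR : A ⊆ R := fun ρ hρ => hρ.1
  have hAne : A.Nonempty := by
    obtain ⟨r, hrT, hr⟩ := hseed hRne
    exact ⟨r, Or.inl ⟨hrT, hr⟩, hT r hrT hr⟩
  have hA : A = R := by
    by_contra hne
    obtain ⟨a, haA, ρ, hρR, hρA, haρ⟩ := hconn A hAR hAne hne
    apply hρA
    refine ⟨hρR, ?_⟩
    rcases hρR with ⟨hρT, hρσ⟩ | ⟨δ, hδD, rfl⟩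
    · exact hT ρ hρT hρσ
    · obtain ⟨hδ, hDδ⟩ := hD δ hδD
      have haδ : B a δ ≠ 0 := by
        intro h0
        apply haρ
        have h1 : B a (σ δ) = B a δ := by rw [← hσB a (σ δ), hfix a (hAR haA), hσσ]
        rw [map_add, h1, h0, add_zero]
      exact oneParamTransvection_add_self_mem hB h2 hσ hσB hC hδ hDδ (hfix a (hAR haA)) haA.2 haδ
  intro ρ hρ
  rw [← hA] at hρ
  exact hρ.2

end Centres

/-! ## §3 Extension from the eigenspaces and the main theorem -/

section Extend

variable [CharZero K] [Module.Finite K V]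

omit [Module.Finite K V] in
/-- **`U^{V₊}_w(c) ⊕ 1 = U^V_w(c)`**: the extension by the identity of a transvection of `(V₊, B|V₊)` is
the transvection of `(V, B)` along the same vector. [cite: GoodmanWallachGTM255, §11.3.5 Type CII (11.10)] -/
theorem extendAlong_oneParamTransvection {σ : V →ₗ[K] V} (hσ : σ ^ 2 = 1)
    (hσB : ∀ x y, B (σ x) (σ y) = B x y) (w : Module.End.eigenspace σ 1) (c : K)
    (e : Module.End.eigenspace σ 1 ≃ₗ[K] Module.End.eigenspace σ 1)
    (he : (e : Module.End.eigenspace σ 1 →ₗ[K] Module.End.eigenspace σ 1) =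
      oneParamTransvection (B.restrict (Module.End.eigenspace σ 1)) w c) :
    ((extendAlong two_ne_zero hσ e : V ≃ₗ[K] V) : Module.End K V) = oneParamTransvection B (w : V) c := by
  ext x
  have hex : e (halfProjCod σ hσ x) = oneParamTransvection (B.restrict (Module.End.eigenspace σ 1)) w c
      (halfProjCod σ hσ x) := LinearMap.congr_fun he _
  have hw : halfProj σ (w : V) = w := halfProj_apply_of_mem two_ne_zero w.2
  have hBw : B x w = B (halfProj σ x) w := by
    rw [apply_eq_add_halfProj two_ne_zero hσ hσB x w, hw, halfProj_neg_coe, map_zero, add_zero]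
  rw [LinearEquiv.coe_coe, extendAlong_apply, hex, oneParamTransvection_apply, oneParamTransvection_apply,
    Submodule.coe_add, Submodule.coe_smul]
  simp only [LinearMap.BilinForm.restrict_apply, LinearMap.domRestrict_apply, coe_halfProjCod]
  rw [hBw, add_right_comm, halfProj_add_halfProj_neg two_ne_zero]

/-- **`Sp(V₊) ⊕ 1 ⊆ C`** — Lemma T on the eigenspace plus extension by the identity: if `C ⊆ End(V)` is
multiplicatively closed, contains `1`, and contains all `U_r(t)` for `r` in a set `R ⊆ V₊` spanning `V₊`
and orthogonally connected, then `C` contains (the map of) `u ⊕ 1` for every isometry `u` of `B|V₊`.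
[cite: Deligne1980, §4.4 Lemme (4.4.2^α) pp. 227–228] [cite: GoodmanWallachGTM255, §11.3.5 Type CII (11.10)] -/
theorem extendAlong_mem_of_connected (hB : B.IsAlt) (hBn : B.Nondegenerate) {σ : V →ₗ[K] V} (hσ : σ ^ 2 = 1)
    (hσB : ∀ x y, B (σ x) (σ y) = B x y) {C : Set (Module.End K V)} (hC : ∀ x ∈ C, ∀ y ∈ C, x * y ∈ C)
    (h1 : (1 : Module.End K V) ∈ C) {R : Set V}
    (hRC : ∀ r ∈ R, ∀ t : K, oneParamTransvection B r t ∈ C)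
    (hspan : Submodule.span K R = Module.End.eigenspace σ 1)
    (hconn : ∀ A ⊆ R, A.Nonempty → A ≠ R → ∃ r ∈ A, ∃ ρ ∈ R, ρ ∉ A ∧ B r ρ ≠ 0)
    (e : Module.End.eigenspace σ 1 ≃ₗ[K] Module.End.eigenspace σ 1)
    (he : ∀ v w, B.restrict (Module.End.eigenspace σ 1) (e v) (e w) = B.restrict (Module.End.eigenspace σ 1) v w) :
    ((extendAlong two_ne_zero hσ e : V ≃ₗ[K] V) : Module.End K V) ∈ C := by
  haveI : Infinite K := Infinite.of_injective ((↑) : ℕ → K) Nat.cast_injective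
  have hRW : R ⊆ (Module.End.eigenspace σ 1) := fun r hr => by rw [← hspan]; exact Submodule.subset_span hr
  let R' : Set (Module.End.eigenspace σ 1) := {w | (w : V) ∈ R}
  have himg : ((↑) : (Module.End.eigenspace σ 1) → V) '' R' = R := by
    ext r
    constructor
    · rintro ⟨w, hw, rfl⟩; exact hw
    · intro hr; exact ⟨⟨r, hRW hr⟩, hr, rfl⟩
  -- `R'` spans `(Module.End.eigenspace σ 1)`
  have hspan' : Submodule.span K R' = ⊤ := by
    apply Submodule.map_injective_of_injective (Module.End.eigenspace σ 1).injective_subtype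
    rw [Submodule.map_span, Submodule.map_subtype_top, Submodule.coe_subtype, himg, hspan]
  -- `R'` is orthogonally connected for `(B.restrict (Module.End.eigenspace σ 1))`
  have hconn' : ∀ A ⊆ R', A.Nonempty → A ≠ R' → ∃ r ∈ A, ∃ ρ ∈ R', ρ ∉ A ∧ (B.restrict (Module.End.eigenspace σ 1)) r ρ ≠ 0 := by
    intro A hAR hAne hAne'
    obtain ⟨a, ⟨a', ha', rfl⟩, ρ, hρR, hρA, haρ⟩ := hconn (((↑) : (Module.End.eigenspace σ 1) → V) '' A)
      (by rintro _ ⟨w, hw, rfl⟩; exact hAR hw) (hAne.image _) (by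
        intro h
        apply hAne'
        apply Set.Subset.antisymm hAR
        intro w hw
        have hw' : (w : V) ∈ ((↑) : (Module.End.eigenspace σ 1) → V) '' A := by rw [h]; exact hw
        obtain ⟨w', hw'A, hww'⟩ := hw'
        rwa [← Subtype.ext hww'])
    refine ⟨a', ha', ⟨ρ, hRW hρR⟩, hρR, fun h => hρA ⟨_, h, rfl⟩, ?_⟩
    rw [LinearMap.BilinForm.restrict_apply]
    exact haρ
  -- Lemma T on `(Module.End.eigenspace σ 1)`
  have hLT : ∀ u : ((Module.End.eigenspace σ 1) →ₗ[K] (Module.End.eigenspace σ 1))ˣ, (∀ x y, (B.restrict (Module.End.eigenspace σ 1)) ((u : (Module.End.eigenspace σ 1) →ₗ[K] (Module.End.eigenspace σ 1)) x) ((u : (Module.End.eigenspace σ 1) →ₗ[K] (Module.End.eigenspace σ 1)) y) = (B.restrict (Module.End.eigenspace σ 1)) x y) →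
      u ∈ oneParamTransvectionGroup (B.restrict (Module.End.eigenspace σ 1)) R' := fun u hu =>
    mem_oneParamTransvectionGroup_of_connected (isAlt_restrict hB (Module.End.eigenspace σ 1))
      (nondegenerate_restrict_eigenspace two_ne_zero hB hBn hσ hσB) hspan' hconn' hu
  -- the extension homomorphism on units
  let ψ : ((Module.End.eigenspace σ 1) →ₗ[K] (Module.End.eigenspace σ 1))ˣ →* (V ≃ₗ[K] V) :=
    (extendAlong two_ne_zero hσ).comp (LinearMap.GeneralLinearGroup.generalLinearEquiv K (Module.End.eigenspace σ 1)).toMonoidHom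
  let G : Subgroup ((Module.End.eigenspace σ 1) →ₗ[K] (Module.End.eigenspace σ 1))ˣ :=
    { carrier := {m | ((ψ m : V ≃ₗ[K] V) : Module.End K V) ∈ C ∧ ((ψ m⁻¹ : V ≃ₗ[K] V) : Module.End K V) ∈ C}
      mul_mem' := fun {x y} hx hy => ⟨by
          rw [map_mul, LinearEquiv.coe_toLinearMap_mul]; exact hC _ hx.1 _ hy.1, by
          rw [_root_.mul_inv_rev, map_mul, LinearEquiv.coe_toLinearMap_mul]; exact hC _ hy.2 _ hx.2⟩
      one_mem' := ⟨by rw [map_one]; exact h1, by rw [inv_one, map_one]; exact h1⟩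
      inv_mem' := fun {x} hx => ⟨hx.2, by rw [inv_inv]; exact hx.1⟩ }
  have hψ : ∀ (m : ((Module.End.eigenspace σ 1) →ₗ[K] (Module.End.eigenspace σ 1))ˣ) (w : (Module.End.eigenspace σ 1)) (c : K), (m : (Module.End.eigenspace σ 1) →ₗ[K] (Module.End.eigenspace σ 1)) = oneParamTransvection (B.restrict (Module.End.eigenspace σ 1)) w c →
      ((ψ m : V ≃ₗ[K] V) : Module.End K V) = oneParamTransvection B (w : V) c := by
    intro m w c hm
    refine extendAlong_oneParamTransvection hσ hσB w c _ ?_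
    change ((LinearMap.GeneralLinearGroup.generalLinearEquiv K (Module.End.eigenspace σ 1) m :
      (Module.End.eigenspace σ 1) ≃ₗ[K] (Module.End.eigenspace σ 1)) :
      (Module.End.eigenspace σ 1) →ₗ[K] (Module.End.eigenspace σ 1)) = _
    rw [LinearMap.GeneralLinearGroup.generalLinearEquiv_to_linearMap]
    exact hm
  have hMG : oneParamTransvectionGroup (B.restrict (Module.End.eigenspace σ 1)) R' ≤ G := by
    refine (Subgroup.closure_le G).2 ?_
    rintro m ⟨w, hw, c, hm⟩
    refine ⟨?_, ?_⟩
    · rw [hψ m w c hm]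
      exact hRC _ hw c
    · rw [hψ m⁻¹ w (-c) (coe_inv_of_coe_eq_oneParamTransvection (isAlt_restrict hB (Module.End.eigenspace σ 1) w) hm)]
      exact hRC _ hw (-c)
  -- conclude for `e`
  let m : ((Module.End.eigenspace σ 1) →ₗ[K] (Module.End.eigenspace σ 1))ˣ := LinearMap.GeneralLinearGroup.ofLinearEquiv e
  have hm : m ∈ oneParamTransvectionGroup (B.restrict (Module.End.eigenspace σ 1)) R' := hLT m he
  have h := (hMG hm).1
  have hψm : ψ m = extendAlong two_ne_zero hσ e := by
    change extendAlong two_ne_zero hσ (LinearMap.GeneralLinearGroup.generalLinearEquiv K (Module.End.eigenspace σ 1) m) = _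
    congr 1
  rwa [hψm] at h

/-- **Sign-symmetric transvection monodromy is Zariski dense in `Sp(V₊) × Sp(V₋)`** (the algebraic half of
"Theorem A", `K`-points, no Goursat): `K` of characteristic `0`, `V` finite-dimensional, `B` alternating
non-degenerate, `σ² = 1`, `B(σx, σy) = B(x, y)`; `Γ ≤ GL(V)`; fixed centres `T` (`U_r(c) ∈ Γ` for some
`c ≠ 0`) and paired centres `D` (`⟨δ, σδ⟩ = 0`, `U_δ(c) U_{σδ}(c) ∈ Γ` for some `c ≠ 0`); for each sign,
`R_± = {r ∈ T | σr = ±r} ∪ {δ ± σδ | δ ∈ D}` spans the `±1`-eigenspace, is orthogonally connected, and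
contains a fixed centre when non-empty. Then every `σ`-commuting `B`-isometry lies in the Zariski closure
`glZariskiClosure Γ`. [cite: Deligne1980, §4.4 Thm (4.4.1), (4.4.2^α)–(4.4.4^α) pp. 227–228]
[cite: GoodmanWallachGTM255, §11.3.5 Type CII (11.10)] -/
theorem mem_glZariskiClosure_of_signSymmetric (hB : B.IsAlt) (hBn : B.Nondegenerate) {σ : V →ₗ[K] V}
    (hσ : σ ^ 2 = 1) (hσB : ∀ x y, B (σ x) (σ y) = B x y) {Γ : Subgroup (V ≃ₗ[K] V)} {T D : Set V}
    (hT : ∀ r ∈ T, ∃ c : K, c ≠ 0 ∧ oneParamTransvectionEquiv B (hB r) c ∈ Γ)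
    (hD : ∀ δ ∈ D, B δ (σ δ) = 0 ∧ ∃ c : K, c ≠ 0 ∧
      oneParamTransvectionEquiv B (hB δ) c * oneParamTransvectionEquiv B (hB (σ δ)) c ∈ Γ)
    (hspanPos : Submodule.span K ({r ∈ T | σ r = r} ∪ (fun δ => δ + σ δ) '' D) = Module.End.eigenspace σ 1)
    (hconnPos : ∀ A ⊆ {r ∈ T | σ r = r} ∪ (fun δ => δ + σ δ) '' D, A.Nonempty →
      A ≠ {r ∈ T | σ r = r} ∪ (fun δ => δ + σ δ) '' D →
      ∃ r ∈ A, ∃ ρ ∈ {r ∈ T | σ r = r} ∪ (fun δ => δ + σ δ) '' D, ρ ∉ A ∧ B r ρ ≠ 0)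
    (hseedPos : ({r ∈ T | σ r = r} ∪ (fun δ => δ + σ δ) '' D).Nonempty → ∃ r ∈ T, σ r = r)
    (hspanNeg : Submodule.span K ({r ∈ T | σ r = -r} ∪ (fun δ => δ - σ δ) '' D) = Module.End.eigenspace σ (-1))
    (hconnNeg : ∀ A ⊆ {r ∈ T | σ r = -r} ∪ (fun δ => δ - σ δ) '' D, A.Nonempty →
      A ≠ {r ∈ T | σ r = -r} ∪ (fun δ => δ - σ δ) '' D →
      ∃ r ∈ A, ∃ ρ ∈ {r ∈ T | σ r = -r} ∪ (fun δ => δ - σ δ) '' D, ρ ∉ A ∧ B r ρ ≠ 0)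
    (hseedNeg : ({r ∈ T | σ r = -r} ∪ (fun δ => δ - σ δ) '' D).Nonempty → ∃ r ∈ T, σ r = -r)
    {g : V ≃ₗ[K] V} (hgσ : ∀ x, g (σ x) = σ (g x)) (hgB : ∀ x y, B (g x) (g y) = B x y) :
    g ∈ glZariskiClosure Γ := by
  classical
  let b := Module.Free.chooseBasis K V
  set S : Set (Module.End K V) := (fun h : V ≃ₗ[K] V => (h : Module.End K V)) '' (Γ : Set (V ≃ₗ[K] V))
    with hS
  set C := zariskiClosureEndOfBasis b S with hCdef
  have hSmul : ∀ x ∈ S, ∀ y ∈ S, x * y ∈ S := by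
    rintro _ ⟨x, hx, rfl⟩ _ ⟨y, hy, rfl⟩
    exact ⟨x * y, Γ.mul_mem hx hy, rfl⟩
  have hC : ∀ x ∈ C, ∀ y ∈ C, x * y ∈ C := fun x hx y hy => mul_mem_zariskiClosureEndOfBasis b hSmul hx hy
  have h1 : (1 : Module.End K V) ∈ C := subset_zariskiClosureEndOfBasis b S ⟨1, Γ.one_mem, rfl⟩
  have hσσ : ∀ x, σ (σ x) = x := fun x => by rw [← Module.End.mul_apply, ← pow_two, hσ, Module.End.one_apply]
  -- fixed centres and pair lines are in `C`
  have hTC : ∀ r ∈ T, ∀ t : K, oneParamTransvection B r t ∈ C := by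
    intro r hr t
    obtain ⟨c, hc, hmem⟩ := hT r hr
    exact oneParamTransvection_mem_closure b (hB r) hc hmem t
  have hDC : ∀ δ ∈ D, B δ (σ δ) = 0 ∧ ∀ s : K, oneParamTransvection B δ s * oneParamTransvection B (σ δ) s ∈ C := by
    intro δ hδ
    obtain ⟨hδσ, c, hc, hmem⟩ := hD δ hδ
    exact ⟨hδσ, fun s => pairLine_mem_closure hB b hδσ hc hmem s⟩
  -- the `+` side
  have hRpos := forall_oneParamTransvection_mem_of_connected hB two_ne_zero hσ hσB hC
    (fun r hr _ => hTC r hr) hDC hconnPos hseedPos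
  have hplus := extendAlong_mem_of_connected hB hBn hσ hσB hC h1 hRpos hspanPos hconnPos (restrictAlong g hgσ)
    (restrictAlong_mem_isometries (B := B) (σ := σ) ⟨hgσ, hgB⟩)
  -- the `-` side: the same for the involution `-σ`
  have hσ' : (-σ) ^ 2 = 1 := neg_sq_eq_one hσ
  have hσB' : ∀ x y, B ((-σ) x) ((-σ) y) = B x y := fun x y => by
    simp only [LinearMap.neg_apply, map_neg, neg_neg, hσB]
  have hgσ' : ∀ x, g ((-σ) x) = (-σ) (g x) := comm_neg hgσ
  have hsetT : {r ∈ T | (-σ) r = r} = {r ∈ T | σ r = -r} := by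
    ext r
    simp only [Set.mem_setOf_eq, LinearMap.neg_apply, neg_eq_iff_eq_neg]
  have hsetD : (fun δ => δ + (-σ) δ) '' D = (fun δ => δ - σ δ) '' D := by
    refine Set.image_congr fun δ _ => ?_
    rw [LinearMap.neg_apply, sub_eq_add_neg]
  have hDC' : ∀ δ ∈ D, B δ ((-σ) δ) = 0 ∧
      ∀ s : K, oneParamTransvection B δ s * oneParamTransvection B ((-σ) δ) s ∈ C := by
    intro δ hδ
    obtain ⟨h0, hs⟩ := hDC δ hδ
    refine ⟨by rw [LinearMap.neg_apply, map_neg, h0, neg_zero], fun s => ?_⟩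
    have e : oneParamTransvection B ((-σ) δ) s = oneParamTransvection B (σ δ) s := by
      rw [LinearMap.neg_apply, ← neg_one_smul K (σ δ), oneParamTransvection_smul, mul_assoc, neg_one_mul, neg_neg,
        mul_one]
    rw [e]
    exact hs s
  have hRneg := forall_oneParamTransvection_mem_of_connected hB two_ne_zero hσ' hσB' hC
    (fun r hr _ => hTC r hr) hDC' (by rw [hsetT, hsetD]; exact hconnNeg) (by
      rw [hsetT, hsetD]
      intro h
      obtain ⟨r, hr, hσr⟩ := hseedNeg h
      exact ⟨r, hr, by rw [LinearMap.neg_apply, hσr, neg_neg]⟩)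
  have hspanNeg' : Submodule.span K ({r ∈ T | (-σ) r = r} ∪ (fun δ => δ + (-σ) δ) '' D) =
      Module.End.eigenspace (-σ) 1 := by
    rw [hsetT, hsetD, hspanNeg, eigenspace_neg_one]
  have hminus := extendAlong_mem_of_connected hB hBn hσ' hσB' hC h1 hRneg hspanNeg'
    (by rw [hsetT, hsetD]; exact hconnNeg) (restrictAlong g hgσ')
    (restrictAlong_mem_isometries (B := B) (σ := -σ) ⟨hgσ', hgB⟩)
  -- assemble `g = (g|V₊ ⊕ 1)(1 ⊕ g|V₋)`
  have hfac := extendAlong_restrictAlong_mul two_ne_zero hσ g hgσ hgσ'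
  rw [mem_glZariskiClosure_iff, ← zariskiClosureEnd_basis_indep b, ← hS, ← hCdef, ← hfac,
    LinearEquiv.coe_toLinearMap_mul]
  exact hC _ hplus _ hminus

end Extend

/-! ## §4 Corollary T′ in sign form: orthogonal connectedness of `R₊` from two orbits and one link -/

section Connected

/-- **Corollary T′ (sign form): the orthogonality graph of `R₊` is connected.** Setting of
`mem_glZariskiClosure_of_signSymmetric` (`char K ≠ 2`, `B` alternating non-degenerate, `σ² = 1` a
`B`-isometry); `Γ = ⟨E⟩ ≤ GL(V)` commutes with `σ` and is generated by elements each acting as a transvection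
`U_r(c)` along a fixed centre `r ∈ T` (`σ r = ±r`) or as a pair `U_δ(c) U_{σδ}(c)`, `δ ∈ D`; the sets `T`
(fixed centres, non-zero, closed under sign, `Γ`-stable) and `D` (paired centres, `⟨δ, σδ⟩ = 0`,
`δ + σδ ≠ 0`, closed under sign, `Γ`-stable) are such that the fixed centres of parity `+`
form ONE `Γ`-orbit up to sign and `D` forms ONE `Γ`-orbit up to sign and up to `σ` (conjugacy of
vanishing cycles within one irreducible discriminant component, Voisin II Prop 3.23), some fixed centre
of parity `+` pairs non-trivially with some `δ ∈ D` (the `B₂` confluence, memo Lemma 4), and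
`R₊ = {r ∈ T | σ r = r} ∪ {δ + σδ | δ ∈ D}` spans `V₊`. Then `R₊` is orthogonally connected: it is not
the disjoint union of two non-empty mutually orthogonal parts. (The memo's proof of T′: an orthogonal
splitting of `R₊` is preserved by every generator, hence by `Γ`; `r` and `-r` are never separated;
so each orbit lies on one side, and the link forbids the two orbits to lie on different sides.) The
`-` version is the same statement for `-σ`. [cite: Deligne1980, §4.4 (4.4.4^α) p. 228] -/
theorem orthogonallyConnected_of_signSymmetric_orbits (hB : B.IsAlt) (hBn : B.Nondegenerate)
    (h2 : (2 : K) ≠ 0) {σ : V →ₗ[K] V} (hσ : σ ^ 2 = 1) (hσB : ∀ x y, B (σ x) (σ y) = B x y)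
    {Γ : Subgroup (V ≃ₗ[K] V)} {E : Set (V ≃ₗ[K] V)} (hΓE : Γ = Subgroup.closure E)
    (hΓσ : ∀ g ∈ Γ, ∀ x, g (σ x) = σ (g x)) {T D : Set V}
    (hE : ∀ e ∈ E, (∃ r ∈ T, ∃ c : K, (e : V →ₗ[K] V) = oneParamTransvection B r c) ∨
      (∃ δ ∈ D, ∃ c : K, (e : V →ₗ[K] V) = oneParamTransvection B δ c * oneParamTransvection B (σ δ) c))
    (hTσ : ∀ r ∈ T, σ r = r ∨ σ r = -r) (hTneg : ∀ r ∈ T, -r ∈ T) (hTst : ∀ g ∈ Γ, ∀ r ∈ T, g r ∈ T)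
    (hT0 : ∀ r ∈ T, σ r = r → r ≠ 0)
    (hDσ0 : ∀ δ ∈ D, B δ (σ δ) = 0) (hDneg : ∀ δ ∈ D, -δ ∈ D) (hDst : ∀ g ∈ Γ, ∀ δ ∈ D, g δ ∈ D)
    (hD0 : ∀ δ ∈ D, δ + σ δ ≠ 0)
    (htransT : ∀ r ∈ T, ∀ r' ∈ T, σ r = r → σ r' = r' → ∃ g ∈ Γ, g r = r' ∨ g r = -r')
    (htransD : ∀ δ ∈ D, ∀ δ' ∈ D, ∃ g ∈ Γ, g δ = δ' ∨ g δ = -δ' ∨ g δ = σ δ' ∨ g δ = -(σ δ'))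
    (hlink : ∃ r ∈ T, σ r = r ∧ ∃ δ ∈ D, B r δ ≠ 0)
    (hspan : Submodule.span K ({r ∈ T | σ r = r} ∪ (fun δ => δ + σ δ) '' D) = Module.End.eigenspace σ 1) :
    ∀ A ⊆ {r ∈ T | σ r = r} ∪ (fun δ => δ + σ δ) '' D, A.Nonempty →
      A ≠ {r ∈ T | σ r = r} ∪ (fun δ => δ + σ δ) '' D →
      ∃ r ∈ A, ∃ ρ ∈ {r ∈ T | σ r = r} ∪ (fun δ => δ + σ δ) '' D, ρ ∉ A ∧ B r ρ ≠ 0 := by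
  set R := {r ∈ T | σ r = r} ∪ (fun δ => δ + σ δ) '' D with hR
  have hσσ : ∀ x, σ (σ x) = x := fun x => by rw [← Module.End.mul_apply, ← pow_two, hσ, Module.End.one_apply]
  have hRfix : ∀ ρ ∈ R, σ ρ = ρ := by
    rintro ρ (⟨-, hρ⟩ | ⟨δ, -, rfl⟩)
    · exact hρ
    · rw [map_add, hσσ, add_comm]
  have hR0 : ∀ ρ ∈ R, ρ ≠ 0 := by
    rintro ρ (⟨hρT, hρ⟩ | ⟨δ, hδ, rfl⟩)
    · exact hT0 ρ hρT hρ
    · exact hD0 δ hδ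
  have hRneg : ∀ ρ ∈ R, -ρ ∈ R := by
    rintro ρ (⟨hρT, hρ⟩ | ⟨δ, hδ, rfl⟩)
    · exact Or.inl ⟨hTneg ρ hρT, by rw [map_neg, hρ]⟩
    · exact Or.inr ⟨-δ, hDneg δ hδ, show -δ + σ (-δ) = -(δ + σ δ) by rw [map_neg, neg_add]⟩
  -- `⟨a, σδ⟩ = ⟨a, δ⟩` for `σ a = a`, and `⟨a, r⟩ = 0` for `σ a = a`, `σ r = -r`
  have hBσ : ∀ a δ : V, σ a = a → B a (σ δ) = B a δ := fun a δ ha => by rw [← hσB a (σ δ), ha, hσσ]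
  have hB0 : ∀ a r : V, σ a = a → σ r = -r → B a r = 0 := by
    intro a r ha hr
    have h : B a r = -B a r := by
      conv_lhs => rw [← hσB, ha, hr, map_neg]
    have h' : (2 : K) * B a r = 0 := by rw [two_mul]; nth_rw 2 [h]; rw [add_neg_cancel]
    exact (mul_eq_zero.1 h').resolve_left h2
  -- `R` is `Γ`-stable
  have hRst : ∀ g ∈ Γ, ∀ a ∈ R, g a ∈ R := by
    rintro g hg a (⟨haT, ha⟩ | ⟨δ, hδ, rfl⟩)
    · exact Or.inl ⟨hTst g hg a haT, by rw [← hΓσ g hg, ha]⟩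
    · exact Or.inr ⟨g δ, hDst g hg δ hδ, by rw [map_add, hΓσ g hg]⟩
  have hEΓ : E ⊆ Γ := by rw [hΓE]; exact Subgroup.subset_closure
  -- the generators act on `R` as transvections along elements of `R` (or trivially)
  have hgen : ∀ e ∈ E, ∀ a ∈ R, e a = a ∨ ∃ ρ ∈ R, ∃ c : K, B a ρ ≠ 0 ∧ e a = a + c • ρ := by
    intro e he a ha
    have hae : ∀ f : V →ₗ[K] V, (e : V →ₗ[K] V) = f → e a = f a := fun f hf => by
      rw [← LinearEquiv.coe_coe, hf]
    rcases hE e he with ⟨r, hr, c, hec⟩ | ⟨δ, hδ, c, hec⟩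
    · rw [hae _ hec, oneParamTransvection_apply]
      rcases hTσ r hr with hσr | hσr
      · by_cases har : B a r = 0
        · left; rw [har, mul_zero, zero_smul, add_zero]
        · right; exact ⟨r, Or.inl ⟨hr, hσr⟩, c * B a r, har, rfl⟩
      · left; rw [hB0 a r (hRfix a ha) hσr, mul_zero, zero_smul, add_zero]
    · rw [hae _ hec, pair_apply_of_fixed hB hσ hσB (hDσ0 δ hδ) (hRfix a ha)]
      by_cases had : B a δ = 0
      · left; rw [had, mul_zero, zero_smul, add_zero]
      · right
        refine ⟨δ + σ δ, Or.inr ⟨δ, hδ, rfl⟩, c * B a δ, ?_, rfl⟩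
        rw [map_add, hBσ a δ (hRfix a ha), ← two_mul]
        exact mul_ne_zero h2 had
  -- bad cuts: parts of `R` orthogonal to their complement in `R`
  intro A hAR hAne hAneR
  by_contra hcon
  push Not at hcon
  let Bad : Set V → Prop := fun A' => A' ⊆ R ∧ ∀ a ∈ A', ∀ ρ ∈ R, ρ ∉ A' → B a ρ = 0
  have hA : Bad A := ⟨hAR, hcon⟩
  have hAc : Bad (R \ A) := by
    refine ⟨Set.sdiff_subset, fun a ha ρ hρ hρA => ?_⟩
    have hρA' : ρ ∈ A := by
      by_contra h
      exact hρA ⟨hρ, h⟩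
    rw [← hB.neg_eq, hcon ρ hρA' a ha.1 ha.2, neg_zero]
  -- every generator maps every bad cut into itself
  have hEbad : ∀ e ∈ E, ∀ A', Bad A' → ∀ a ∈ A', e a ∈ A' := by
    intro e he A' hA' a ha
    rcases hgen e he a (hA'.1 ha) with h0 | ⟨ρ, hρR, c, haρ, hea⟩
    · rw [h0]; exact ha
    · have hρA : ρ ∈ A' := by
        by_contra h
        exact haρ (hA'.2 a ha ρ hρR h)
      have heaR : e a ∈ R := hRst e (hEΓ he) a (hA'.1 ha)
      by_contra h
      have h0 := hA'.2 ρ hρA (e a) heaR h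
      rw [hea, map_add, map_smul, hB ρ, smul_zero, add_zero] at h0
      exact haρ (by rw [← hB.neg_eq, h0, neg_zero])
  -- hence every element of `Γ` does (with its inverse)
  have hΓbad : ∀ g ∈ Γ, ∀ A', Bad A' → ∀ a ∈ A', g a ∈ A' ∧ g⁻¹ a ∈ A' := by
    intro g hg
    rw [hΓE] at hg
    induction hg using Subgroup.closure_induction with
    | mem e he =>
      intro A' hA' a ha
      refine ⟨hEbad e he A' hA' a ha, ?_⟩
      -- `e⁻¹ a ∈ R`; if it were in the complementary bad cut, so would be `a = e (e⁻¹ a)`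
      have hcomp : Bad (R \ A') := by
        refine ⟨Set.sdiff_subset, fun x hx ρ hρ hρx => ?_⟩
        have hρA' : ρ ∈ A' := by
          by_contra h
          exact hρx ⟨hρ, h⟩
        rw [← hB.neg_eq, hA'.2 ρ hρA' x hx.1 hx.2, neg_zero]
      have hinvR : e⁻¹ a ∈ R := hRst _ (Γ.inv_mem (hEΓ he)) a (hA'.1 ha)
      by_contra h
      have h' := hEbad e he _ hcomp (e⁻¹ a) ⟨hinvR, h⟩
      rw [← LinearEquiv.mul_apply, mul_inv_cancel, LinearEquiv.coe_one, id_eq] at h'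
      exact h'.2 ha
    | one => intro A' _ a ha; exact ⟨ha, by rw [inv_one]; exact ha⟩
    | mul g h _ _ ihg ihh =>
      intro A' hA' a ha
      refine ⟨?_, ?_⟩
      · rw [LinearEquiv.mul_apply]; exact (ihg A' hA' _ (ihh A' hA' a ha).1).1
      · rw [_root_.mul_inv_rev, LinearEquiv.mul_apply]; exact (ihh A' hA' _ (ihg A' hA' a ha).2).2
    | inv g _ ih =>
      intro A' hA' a ha
      exact ⟨(ih A' hA' a ha).2, by rw [inv_inv]; exact (ih A' hA' a ha).1⟩
  -- a bad cut is closed under sign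
  have hneg : ∀ A', Bad A' → ∀ a ∈ A', -a ∈ A' := by
    intro A' hA' a ha
    have haR := hA'.1 ha
    -- some `s ∈ R` pairs non-trivially with `a`
    obtain ⟨s, hsR, has⟩ : ∃ s ∈ R, B a s ≠ 0 := by
      by_contra h
      push Not at h
      apply hR0 a haR
      refine hBn.1 a fun v => ?_
      have hsp : ∀ w ∈ Submodule.span K R, B a w = 0 := by
        intro w hw
        induction hw using Submodule.span_induction with
        | mem x hx => exact h x hx
        | zero => rw [map_zero]
        | add x y _ _ hx hy => rw [map_add, hx, hy, add_zero]
        | smul c x _ hx => rw [map_smul, hx, smul_zero]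
      rw [apply_eq_add_halfProj h2 hσ hσB a v, halfProj_apply_of_mem h2 (by
          rw [Module.End.mem_eigenspace_iff, one_smul]; exact hRfix a haR),
        halfProj_neg_apply_of_mem (by rw [Module.End.mem_eigenspace_iff, one_smul]; exact hRfix a haR),
        map_zero, LinearMap.zero_apply, add_zero]
      exact hsp _ (hspan ▸ halfProj_mem_eigenspace hσ v)
    have hsA : s ∈ A' := by
      by_contra h
      exact has (hA'.2 a ha s hsR h)
    by_contra h
    have h0 := hA'.2 s hsA (-a) (hRneg a haR) h
    rw [map_neg, ← hB.neg_eq, neg_neg] at h0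
    exact has h0
  -- each orbit lies on one side
  have hTside : ∀ A', Bad A' → ∀ r₀ ∈ A', r₀ ∈ T → ∀ r ∈ T, σ r = r → r ∈ A' := by
    intro A' hA' r₀ hr₀ hr₀T r hrT hr
    obtain ⟨g, hg, hgr⟩ := htransT r₀ hr₀T r hrT (hRfix r₀ (hA'.1 hr₀)) hr
    have h := (hΓbad g hg A' hA' r₀ hr₀).1
    rcases hgr with hgr | hgr
    · rwa [hgr] at h
    · rw [hgr] at h
      have := hneg A' hA' _ h
      rwa [neg_neg] at this
  have hDside : ∀ A', Bad A' → ∀ δ₀ ∈ D, δ₀ + σ δ₀ ∈ A' → ∀ δ ∈ D, δ + σ δ ∈ A' := by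
    intro A' hA' δ₀ hδ₀ hf₀ δ hδ
    obtain ⟨g, hg, hgδ⟩ := htransD δ₀ hδ₀ δ hδ
    have h := (hΓbad g hg A' hA' _ hf₀).1
    rw [map_add, hΓσ g hg] at h
    rcases hgδ with e | e | e | e <;> rw [e] at h
    · exact h
    · rw [map_neg, ← neg_add] at h
      have := hneg A' hA' _ h
      rwa [neg_neg] at this
    · rwa [hσσ, add_comm] at h
    · rw [map_neg, hσσ, ← neg_add, add_comm] at h
      have := hneg A' hA' _ h
      rwa [neg_neg] at this
  -- the link forces `A = R`
  obtain ⟨rL, hrLT, hrL, δL, hδL, hlink'⟩ := hlink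
  have hfL : B rL (δL + σ δL) ≠ 0 := by
    rw [map_add, hBσ rL δL hrL, ← two_mul]
    exact mul_ne_zero h2 hlink'
  have key : ∀ A', Bad A' → A'.Nonempty → A' = R := by
    intro A' hA' hne
    -- `A'` contains all of `T₊` and all of `F₊`
    have hboth : (∀ r ∈ T, σ r = r → r ∈ A') ∧ ∀ δ ∈ D, δ + σ δ ∈ A' := by
      obtain ⟨a, ha⟩ := hne
      rcases hA'.1 ha with ⟨haT, haσ⟩ | ⟨δ, hδ, rfl⟩
      · have hT' : ∀ r ∈ T, σ r = r → r ∈ A' := hTside A' hA' a ha haT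
        have hf : δL + σ δL ∈ A' := by
          by_contra h
          exact hfL (hA'.2 rL (hT' rL hrLT hrL) _ (Or.inr ⟨δL, hδL, rfl⟩) h)
        exact ⟨hT', hDside A' hA' δL hδL hf⟩
      · have hD' : ∀ δ ∈ D, δ + σ δ ∈ A' := hDside A' hA' δ hδ ha
        have hr : rL ∈ A' := by
          by_contra h
          have h0 := hA'.2 _ (hD' δL hδL) rL (Or.inl ⟨hrLT, hrL⟩) h
          rw [← hB.neg_eq, neg_eq_zero] at h0
          exact hfL h0
        exact ⟨hTside A' hA' rL hr hrLT, hD'⟩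
    refine Set.Subset.antisymm hA'.1 ?_
    rintro ρ (⟨hρT, hρ⟩ | ⟨δ, hδ, rfl⟩)
    · exact hboth.1 ρ hρT hρ
    · exact hboth.2 δ hδ
  exact hAneR (key A hA hAne)

/-- **Corollary T′ (sign form), parity `-`**: the same statement for the `(-1)`-eigenspace —
`R₋ = {r ∈ T | σ r = -r} ∪ {δ - σδ | δ ∈ D}` is orthogonally connected as soon as the fixed centres of
parity `-` form one `Γ`-orbit up to sign, `D` forms one `Γ`-orbit up to sign and up to `σ`, some fixed
centre of parity `-` pairs non-trivially with some `δ ∈ D`, and `R₋` spans `V₋` (the `+` statement for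
the involution `-σ`). Produces the hypothesis `hconnNeg` of `mem_glZariskiClosure_of_signSymmetric`
verbatim. [cite: Deligne1980, §4.4 (4.4.4^α) p. 228] -/
theorem orthogonallyConnected_of_signSymmetric_orbits_neg (hB : B.IsAlt) (hBn : B.Nondegenerate)
    (h2 : (2 : K) ≠ 0) {σ : V →ₗ[K] V} (hσ : σ ^ 2 = 1) (hσB : ∀ x y, B (σ x) (σ y) = B x y)
    {Γ : Subgroup (V ≃ₗ[K] V)} {E : Set (V ≃ₗ[K] V)} (hΓE : Γ = Subgroup.closure E)
    (hΓσ : ∀ g ∈ Γ, ∀ x, g (σ x) = σ (g x)) {T D : Set V}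
    (hE : ∀ e ∈ E, (∃ r ∈ T, ∃ c : K, (e : V →ₗ[K] V) = oneParamTransvection B r c) ∨
      (∃ δ ∈ D, ∃ c : K, (e : V →ₗ[K] V) = oneParamTransvection B δ c * oneParamTransvection B (σ δ) c))
    (hTσ : ∀ r ∈ T, σ r = r ∨ σ r = -r) (hTneg : ∀ r ∈ T, -r ∈ T) (hTst : ∀ g ∈ Γ, ∀ r ∈ T, g r ∈ T)
    (hT0 : ∀ r ∈ T, σ r = -r → r ≠ 0)
    (hDσ0 : ∀ δ ∈ D, B δ (σ δ) = 0) (hDneg : ∀ δ ∈ D, -δ ∈ D) (hDst : ∀ g ∈ Γ, ∀ δ ∈ D, g δ ∈ D)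
    (hD0 : ∀ δ ∈ D, δ - σ δ ≠ 0)
    (htransT : ∀ r ∈ T, ∀ r' ∈ T, σ r = -r → σ r' = -r' → ∃ g ∈ Γ, g r = r' ∨ g r = -r')
    (htransD : ∀ δ ∈ D, ∀ δ' ∈ D, ∃ g ∈ Γ, g δ = δ' ∨ g δ = -δ' ∨ g δ = σ δ' ∨ g δ = -(σ δ'))
    (hlink : ∃ r ∈ T, σ r = -r ∧ ∃ δ ∈ D, B r δ ≠ 0)
    (hspan : Submodule.span K ({r ∈ T | σ r = -r} ∪ (fun δ => δ - σ δ) '' D) =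
      Module.End.eigenspace σ (-1)) :
    ∀ A ⊆ {r ∈ T | σ r = -r} ∪ (fun δ => δ - σ δ) '' D, A.Nonempty →
      A ≠ {r ∈ T | σ r = -r} ∪ (fun δ => δ - σ δ) '' D →
      ∃ r ∈ A, ∃ ρ ∈ {r ∈ T | σ r = -r} ∪ (fun δ => δ - σ δ) '' D, ρ ∉ A ∧ B r ρ ≠ 0 := by
  have hσ' : (-σ) ^ 2 = 1 := neg_sq_eq_one hσ
  have hσB' : ∀ x y, B ((-σ) x) ((-σ) y) = B x y := fun x y => by
    simp only [LinearMap.neg_apply, map_neg, neg_neg, hσB]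
  have hflip : ∀ r, (-σ) r = r ↔ σ r = -r := fun r => by rw [LinearMap.neg_apply, neg_eq_iff_eq_neg]
  have hsetT : {r ∈ T | (-σ) r = r} = {r ∈ T | σ r = -r} := by
    ext r
    simp only [Set.mem_setOf_eq, hflip]
  have hsetD : (fun δ => δ + (-σ) δ) '' D = (fun δ => δ - σ δ) '' D := by
    refine Set.image_congr fun δ _ => ?_
    rw [LinearMap.neg_apply, sub_eq_add_neg]
  have hΓσ' : ∀ g ∈ Γ, ∀ x, g ((-σ) x) = (-σ) (g x) := fun g hg => comm_neg (hΓσ g hg)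
  have hE' : ∀ e ∈ E, (∃ r ∈ T, ∃ c : K, (e : V →ₗ[K] V) = oneParamTransvection B r c) ∨
      (∃ δ ∈ D, ∃ c : K, (e : V →ₗ[K] V) =
        oneParamTransvection B δ c * oneParamTransvection B ((-σ) δ) c) := by
    intro e he
    rcases hE e he with h1 | ⟨δ, hδ, c, hec⟩
    · exact Or.inl h1
    · refine Or.inr ⟨δ, hδ, c, ?_⟩
      rw [hec, LinearMap.neg_apply, ← neg_one_smul K (σ δ), oneParamTransvection_smul, mul_assoc, neg_one_mul,
        neg_neg, mul_one]
  have hTσ' : ∀ r ∈ T, (-σ) r = r ∨ (-σ) r = -r := by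
    intro r hr
    rcases hTσ r hr with h1 | h1
    · exact Or.inr (by rw [LinearMap.neg_apply, h1])
    · exact Or.inl (by rw [LinearMap.neg_apply, h1, neg_neg])
  have hT0' : ∀ r ∈ T, (-σ) r = r → r ≠ 0 := fun r hr h1 => hT0 r hr ((hflip r).1 h1)
  have hDσ0' : ∀ δ ∈ D, B δ ((-σ) δ) = 0 := fun δ hδ => by
    rw [LinearMap.neg_apply, map_neg, hDσ0 δ hδ, neg_zero]
  have hD0' : ∀ δ ∈ D, δ + (-σ) δ ≠ 0 := fun δ hδ => by
    rw [LinearMap.neg_apply, ← sub_eq_add_neg]; exact hD0 δ hδ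
  have htransT' : ∀ r ∈ T, ∀ r' ∈ T, (-σ) r = r → (-σ) r' = r' → ∃ g ∈ Γ, g r = r' ∨ g r = -r' :=
    fun r hr r' hr' h1 h1' => htransT r hr r' hr' ((hflip r).1 h1) ((hflip r').1 h1')
  have htransD' : ∀ δ ∈ D, ∀ δ' ∈ D, ∃ g ∈ Γ,
      g δ = δ' ∨ g δ = -δ' ∨ g δ = (-σ) δ' ∨ g δ = -((-σ) δ') := by
    intro δ hδ δ' hδ'
    obtain ⟨g, hg, hgδ⟩ := htransD δ hδ δ' hδ'
    refine ⟨g, hg, ?_⟩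
    rw [LinearMap.neg_apply, neg_neg]
    rcases hgδ with e | e | e | e
    · exact Or.inl e
    · exact Or.inr (Or.inl e)
    · exact Or.inr (Or.inr (Or.inr e))
    · exact Or.inr (Or.inr (Or.inl e))
  have hlink' : ∃ r ∈ T, (-σ) r = r ∧ ∃ δ ∈ D, B r δ ≠ 0 := by
    obtain ⟨r, hr, hσr, δ, hδ, hrδ⟩ := hlink
    exact ⟨r, hr, (hflip r).2 hσr, δ, hδ, hrδ⟩
  have hspan' : Submodule.span K ({r ∈ T | (-σ) r = r} ∪ (fun δ => δ + (-σ) δ) '' D) =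
      Module.End.eigenspace (-σ) 1 := by
    rw [hsetT, hsetD, hspan, eigenspace_neg_one]
  have h := orthogonallyConnected_of_signSymmetric_orbits hB hBn h2 hσ' hσB' hΓE hΓσ' hE' hTσ' hTneg hTst hT0'
    hDσ0' hDneg hDst hD0' htransT' htransD' hlink' hspan'
  rwa [hsetT, hsetD] at h

end Connected

/-! ## §5 The sign-symmetric centraliser lies in the identity component `(Γ^Zar)°` -/

section IdentityComponent

/-- Powers of a transvection unit: `U_r(c)^m = U_r(m c)` as automorphisms.
[cite: Deligne1980, §4.4 Lemme (4.4.2^α) p. 227] -/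
theorem oneParamTransvectionEquiv_pow {r : V} (hr : B r r = 0) (c : K) (m : ℕ) :
    oneParamTransvectionEquiv B hr c ^ m = oneParamTransvectionEquiv B hr ((m : K) * c) := by
  apply LinearEquiv.toLinearMap_injective
  rw [coe_oneParamTransvectionEquiv_pow, coe_oneParamTransvectionEquiv]

/-- The two transvections of a pair commute: `U_δ(c) U_{δ'}(c) = U_{δ'}(c) U_δ(c)` for `⟨δ, δ'⟩ = 0`.
[cite: Deligne1980, §4.4 Lemme (4.4.2^α) p. 227] -/
theorem commute_oneParamTransvectionEquiv (hB : B.IsAlt) {δ δ' : V} (h : B δ δ' = 0) (c : K) :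
    Commute (oneParamTransvectionEquiv B (hB δ) c) (oneParamTransvectionEquiv B (hB δ') c) := by
  have h' : B δ' δ = 0 := by rw [← hB.neg_eq, h, neg_zero]
  change _ * _ = _ * _
  apply LinearEquiv.toLinearMap_injective
  rw [LinearEquiv.coe_toLinearMap_mul, coe_oneParamTransvectionEquiv, coe_oneParamTransvectionEquiv,
    oneParamTransvection_mul_eq_one_add_smul hB h, LinearEquiv.coe_toLinearMap_mul, coe_oneParamTransvectionEquiv,
    coe_oneParamTransvectionEquiv, oneParamTransvection_mul_eq_one_add_smul hB h', add_comm ((B.flip δ').smulRight δ')]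

/-- Powers of a pair: `(U_δ(c) U_{δ'}(c))^m = U_δ(m c) U_{δ'}(m c)` for `⟨δ, δ'⟩ = 0`.
[cite: Deligne1980, §4.4 Lemme (4.4.2^α) p. 227] -/
theorem pair_oneParamTransvectionEquiv_pow (hB : B.IsAlt) {δ δ' : V} (h : B δ δ' = 0) (c : K) (m : ℕ) :
    (oneParamTransvectionEquiv B (hB δ) c * oneParamTransvectionEquiv B (hB δ') c) ^ m =
      oneParamTransvectionEquiv B (hB δ) ((m : K) * c) * oneParamTransvectionEquiv B (hB δ') ((m : K) * c) := by
  rw [(commute_oneParamTransvectionEquiv hB h c).mul_pow, oneParamTransvectionEquiv_pow, oneParamTransvectionEquiv_pow]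

variable [CharZero K] [Module.Finite K V]

/-- **The sign-symmetric centraliser lies in `(Γ^Zar)°(K)`** — the "`Mon⁰ ⊇ Sp(V₊) × Sp(V₋)`" half of
Theorem A on `K`-points: under the hypotheses of `mem_glZariskiClosure_of_signSymmetric`, every
`σ`-commuting `B`-isometry lies in the tree's identity component `glIdentityComponent Γ` (the intersection
of the closures of all finite-index subgroups `Γ' ≤ Γ`; for the monodromy group this is
`algebraicMonodromyGroup = Mon_s`), because a finite-index `Γ'` contains a positive power
`U_r(c)^m = U_r(mc)`, `(U_δ(c)U_{σδ}(c))^m = U_δ(mc)U_{σδ}(mc)` of each generator (`mc ≠ 0` in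
characteristic `0`) and the remaining hypotheses do not mention `Γ`. CMSP: "replacing `Γ` by
`Γ ∩ Mon(𝒫)`, a group of finite index in `Γ`". [cite: Deligne1980, §4.4 Thm (4.4.1), (4.4.2^α)–(4.4.4^α) pp. 227–228]
[cite: CarlsonMullerStachPeters2017, Lemma–Definition 15.3.7 and proof of Proposition 15.3.9] -/
theorem mem_glIdentityComponent_of_signSymmetric (hB : B.IsAlt) (hBn : B.Nondegenerate) {σ : V →ₗ[K] V}
    (hσ : σ ^ 2 = 1) (hσB : ∀ x y, B (σ x) (σ y) = B x y) {Γ : Subgroup (V ≃ₗ[K] V)} {T D : Set V}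
    (hT : ∀ r ∈ T, ∃ c : K, c ≠ 0 ∧ oneParamTransvectionEquiv B (hB r) c ∈ Γ)
    (hD : ∀ δ ∈ D, B δ (σ δ) = 0 ∧ ∃ c : K, c ≠ 0 ∧
      oneParamTransvectionEquiv B (hB δ) c * oneParamTransvectionEquiv B (hB (σ δ)) c ∈ Γ)
    (hspanPos : Submodule.span K ({r ∈ T | σ r = r} ∪ (fun δ => δ + σ δ) '' D) = Module.End.eigenspace σ 1)
    (hconnPos : ∀ A ⊆ {r ∈ T | σ r = r} ∪ (fun δ => δ + σ δ) '' D, A.Nonempty →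
      A ≠ {r ∈ T | σ r = r} ∪ (fun δ => δ + σ δ) '' D →
      ∃ r ∈ A, ∃ ρ ∈ {r ∈ T | σ r = r} ∪ (fun δ => δ + σ δ) '' D, ρ ∉ A ∧ B r ρ ≠ 0)
    (hseedPos : ({r ∈ T | σ r = r} ∪ (fun δ => δ + σ δ) '' D).Nonempty → ∃ r ∈ T, σ r = r)
    (hspanNeg : Submodule.span K ({r ∈ T | σ r = -r} ∪ (fun δ => δ - σ δ) '' D) = Module.End.eigenspace σ (-1))
    (hconnNeg : ∀ A ⊆ {r ∈ T | σ r = -r} ∪ (fun δ => δ - σ δ) '' D, A.Nonempty →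
      A ≠ {r ∈ T | σ r = -r} ∪ (fun δ => δ - σ δ) '' D →
      ∃ r ∈ A, ∃ ρ ∈ {r ∈ T | σ r = -r} ∪ (fun δ => δ - σ δ) '' D, ρ ∉ A ∧ B r ρ ≠ 0)
    (hseedNeg : ({r ∈ T | σ r = -r} ∪ (fun δ => δ - σ δ) '' D).Nonempty → ∃ r ∈ T, σ r = -r)
    {g : V ≃ₗ[K] V} (hgσ : ∀ x, g (σ x) = σ (g x)) (hgB : ∀ x y, B (g x) (g y) = B x y) :
    g ∈ glIdentityComponent Γ := by
  rw [mem_glIdentityComponent_iff]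
  intro Γ' _ hfi
  have hidx : (Γ'.subgroupOf Γ).index ≠ 0 := hfi.index_ne_zero
  refine mem_glZariskiClosure_of_signSymmetric hB hBn hσ hσB (Γ := Γ') ?_ ?_ hspanPos hconnPos hseedPos hspanNeg
    hconnNeg hseedNeg hgσ hgB
  · intro r hr
    obtain ⟨c, hc, hmem⟩ := hT r hr
    obtain ⟨m, hm0, -, hm⟩ := Subgroup.exists_pow_mem_of_index_ne_zero hidx (⟨_, hmem⟩ : Γ)
    rw [Subgroup.mem_subgroupOf, Subgroup.coe_pow, oneParamTransvectionEquiv_pow] at hm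
    exact ⟨(m : K) * c, mul_ne_zero (Nat.cast_ne_zero.2 hm0.ne') hc, hm⟩
  · intro δ hδ
    obtain ⟨hδσ, c, hc, hmem⟩ := hD δ hδ
    obtain ⟨m, hm0, -, hm⟩ := Subgroup.exists_pow_mem_of_index_ne_zero hidx (⟨_, hmem⟩ : Γ)
    rw [Subgroup.mem_subgroupOf, Subgroup.coe_pow, pair_oneParamTransvectionEquiv_pow hB hδσ] at hm
    exact ⟨hδσ, (m : K) * c, mul_ne_zero (Nat.cast_ne_zero.2 hm0.ne') hc, hm⟩

end IdentityComponent

end Literature.AlgebraicGeometry.HodgeTheory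

end
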